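import Mathlib
import HarnessLib
import Summits.Ventures.LatticeQCDFlow.Scoring.BatchMeansTauIntCLT
import Summits.Ventures.LatticeQCDFlow.Scoring.TwoCodeAgreementInProbability
import Summits.Ventures.LatticeQCDFlow.Scoring.AsymptoticCoverage

/-!
# THE SAMPLER-COMPARISON TEST ON COST-WEIGHTED `τ_int` IS CALIBRATED: under `c₁ τ_int,1 = c₂ τ_int,2`,
# `(c₁ τ̂₁ − c₂ τ̂₂)/√(2c₁²τ̂₁²/n + 2c₂²τ̂₂²/m) ⇒ N(0, 1)` for two independent samplers from any starts

HONEST FRAMING: exact (Metropolis-corrected) sampling algorithms for lattice gauge theory;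
figures of merit are autocorrelation/cost numbers at stated couplings and volumes; no
continuum-physics claim.

Venture `LatticeQCDFlow` (cell pub-lqcd), topic `Scoring`; FANOUT row 4 (`s0-u1-b`, GEN-30).
NEW WORK of the cell, not a published result; no definition is introduced; nothing is cited as a
fact.  The cell's verdict "sampler 1 beats sampler 2" compares the cost-weighted integrated
autocorrelation times `c₁ τ_int,1` vs `c₂ τ_int,2` (`c₁ > 0`, `c₂` the costs of one update) of one physical
observable under two DIFFERENT Markov kernels `κ₁`, `κ₂` (possibly on different state spaces, with
their own invariant laws and observables `f₁`, `f₂`), each run independently from an arbitrary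
start and analysed by batch means (`τ̂ᵢ = σ̂ᵢ²/(2 v̂ᵢ)`, `n` resp. `m_n` batches of lengths
`b₁(n)`, `b₂(m_n)`; `bᵢ, m → ∞`, `n/bᵢ(n)² → 0`).  THIS FILE PROVES THE NULL CALIBRATION OF THE
TEST: if `c₁ τ_int,1 = c₂ τ_int,2` then the studentised difference
`(c₁ τ̂₁ − c₂ τ̂₂)/√(2 c₁² τ̂₁²/n + 2 c₂² τ̂₂²/m_n)` converges in distribution to `N(0, 1)` on the
product of the two path spaces, and `P(|…| ≤ z) → N(0,1)([−z, z])` — so "different at `z σ`" has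
asymptotically its nominal size.  Hypotheses per sampler: a geometric envelope (every Doeblin
power), `|fᵢ| ≤ Cᵢ` measurable, `Var_πᵢ fᵢ ≠ 0`, and `σ²_f₁ > 0` (the null then forces `τ_int,2 > 0`).  Assembly: one-run `τ̂_int` CLTs and
consistency (`Scoring/BatchMeansTauIntCLT.lean`), scaling by `cᵢ`, and the cell's two-sample
Slutsky lemma `Scoring/TwoCodeAgreementInProbability.twoSample_agreement_clt_of_tendstoInMeasure`.

## Content

* `chain_batchMeans_costTauInt_clt_of_envelope`, `chain_batchMeans_costTauInt_errorBar_tendstoInMeasure_of_envelope`,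
  `measurable_costTauInt`, `tauInt_pos_of_greenKubo_pos`, `hasLaw_sqrt_two_mul_const_mul_gaussian` —
  one-sampler ingredients (cost-weighted CLT indexed by the number of batches, consistent error bar);
* **`chain_batchMeans_twoSampler_costTauInt_clt_of_envelope`** — `Y, Z ~ N(0, 1)` auxiliary,
  `c₁ τ_int,1 = c₂ τ_int,2`:
  `TendstoInDistribution (fun n ω => (c₁ τ̂₁,n(ω.1) − c₂ τ̂₂,m_n(ω.2)) / √(2(c₁ τ̂₁,n(ω.1))²/n + 2(c₂ τ̂₂,m_n(ω.2))²/m_n)) atTop Z (fun _ => P¹_{μ₁} ⊗ P²_{μ₂}) P'`;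
* **`chain_batchMeans_twoSampler_costTauInt_coverage_of_envelope`** — for every `z`, the
  probability of `|…| ≤ z` tends to `(gaussianReal 0 1)[−z, z]`.

NOT CLAIMED: the power of the test (see `Scoring/AgreementTestPower.lean` for the generic
divergence under a fixed alternative); dependent runs; `σ²_f = 0`.
-/

noncomputable section

namespace Summit.Ventures.LatticeQCDFlow.Scoring

open MeasureTheory ProbabilityTheory Filter Finset Preorder
open scoped ENNReal Topology

variable {Ω₁ : Type*} [MeasurableSpace Ω₁] {Ω₂ : Type*} [MeasurableSpace Ω₂]
variable {κ₁ : Kernel Ω₁ Ω₁} [IsMarkovKernel κ₁] {π₁ : Measure Ω₁} [IsProbabilityMeasure π₁]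
  {A₁ ρ₁ : ℝ}
variable {κ₂ : Kernel Ω₂ Ω₂} [IsMarkovKernel κ₂] {π₂ : Measure Ω₂} [IsProbabilityMeasure π₂]
  {A₂ ρ₂ : ℝ}

section OneSampler

variable {Ω : Type*} [MeasurableSpace Ω]
variable {κ : Kernel Ω Ω} [IsMarkovKernel κ] {π : Measure Ω} [IsProbabilityMeasure π] {A ρ : ℝ}

omit [MeasurableSpace Ω₁] [MeasurableSpace Ω₂] in
/-- `Y ~ N(0, 1)` ⇒ `√2 r · Y ~ N(0, 2 r²)`. -/
theorem hasLaw_sqrt_two_mul_const_mul_gaussian {Ω' : Type*} [MeasurableSpace Ω'] {P' : Measure Ω'}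
    {Y : Ω' → ℝ} (hY : HasLaw Y (gaussianReal 0 1) P') (r : ℝ) :
    HasLaw (fun ω => Real.sqrt 2 * r * Y ω) (gaussianReal 0 (Real.toNNReal (2 * r ^ 2))) P' := by
  refine ⟨hY.aemeasurable.const_mul _, ?_⟩
  rw [show (fun ω => Real.sqrt 2 * r * Y ω) = (fun t : ℝ => (Real.sqrt 2 * r) * t) ∘ Y from rfl,
    ← AEMeasurable.map_map_of_aemeasurable (measurable_const_mul _).aemeasurable hY.aemeasurable,
    hY.map_eq, gaussianReal_map_const_mul, mul_zero, mul_one]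
  congr 1
  apply NNReal.coe_injective
  rw [NNReal.coe_mk, Real.coe_toNNReal _ (by positivity), mul_pow, Real.sq_sqrt (by norm_num)]

omit [MeasurableSpace Ω₁] [MeasurableSpace Ω₂] in
/-- **The cost-weighted `τ̂_int` CLT of one sampler, indexed by the number of batches**: envelope,
any start, `Var_π f ≠ 0`, `b_n → ∞`, `n/b_n² → 0`, `c` real; for `Y ~ N(0, 1)`:
`√n (c τ̂_n − c τ_int) ⇒ √2 (c τ_int) · Y`. -/
theorem chain_batchMeans_costTauInt_clt_of_envelope (hπ : Kernel.Invariant κ π)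
    (henv : ∀ (g : Ω → ℝ), Measurable g → ∀ (Cg : ℝ), (∀ x, |g x| ≤ Cg) →
      ∀ (t : ℕ) (x : Ω), |(kop κ)^[t] g x - ∫ y, g y ∂π| ≤ 2 * Cg * (A * ρ ^ t))
    (hA : 0 ≤ A) (hρ0 : 0 ≤ ρ) (hρ1 : ρ < 1)
    {f : Ω → ℝ} (hf : Measurable f) {C : ℝ} (hC : ∀ x, |f x| ≤ C)
    (hvar : autocov κ π (fun y => f y - ∫ z, f z ∂π) 0 ≠ 0)
    (μ₀ : Measure Ω) [IsProbabilityMeasure μ₀] {b : ℕ → ℕ} (hb : Tendsto b atTop atTop)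
    (hab : Tendsto (fun n : ℕ => (n : ℝ) / (b n : ℝ) ^ 2) atTop (𝓝 0)) (c : ℝ)
    {Ω' : Type*} [MeasurableSpace Ω'] {P' : Measure Ω'} [IsProbabilityMeasure P'] {Y : Ω' → ℝ}
    (hY : HasLaw Y (gaussianReal 0 1) P') [IsProbabilityMeasure (Kernel.trajMeasure (X := fun _ : ℕ
          => Ω) (μ₀)
          (fun n : ℕ => κ.comap (fun h' : (i : ↥(Finset.Iic n)) → Ω => h' ⟨n, Finset.mem_Iic.2
                le_rfl⟩)
            (measurable_pi_apply _)))] :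
    TendstoInDistribution (fun (n : ℕ) (x : ℕ → Ω) =>
        Real.sqrt n * (c * (((((b n) * (n) : ℕ) : ℝ) * replicaSEsq (fun j (x : ℕ → Ω) => (∑ i ∈
              Finset.range (b n), f (x ((b n) * j + i))) / (b n)) (n) x) / (2 * ((∑ t ∈
              Finset.range ((b n) * (n)), f (x t) ^ 2) / (((b n) * (n) : ℕ) : ℝ) - ((∑ t ∈
              Finset.range ((b n) * (n)), f (x t)) / (((b n) * (n) : ℕ) : ℝ)) ^ 2))) - c * tauInt
              (fun t => autocov (κ) (π) (fun y => f y - ∫ z, f z ∂(π)) t / autocov (κ) (π) (fun y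
              => f y - ∫ z, f z ∂(π)) 0)))
      atTop (fun ω => Real.sqrt 2 * (c * tauInt (fun t => autocov (κ) (π) (fun y => f y - ∫ z, f z
            ∂(π)) t / autocov (κ) (π) (fun y => f y - ∫ z, f z ∂(π)) 0)) * Y ω) (fun _ =>
            (Kernel.trajMeasure (X := fun _ : ℕ => Ω) (μ₀)
            (fun n : ℕ => κ.comap (fun h' : (i : ↥(Finset.Iic n)) → Ω => h' ⟨n, Finset.mem_Iic.2
                  le_rfl⟩)
              (measurable_pi_apply _)))) P' := by
  have hclt := chain_batchMeans_tauInt_clt_of_envelope hπ henv hA hρ0 hρ1 hf hC hvar μ₀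
    (a := fun n => n) (b := b) tendsto_id hb hab hY
  exact (hclt.continuous_comp (continuous_const_mul c)).congr
    (fun n => ae_of_all _ fun x => (by
      show c * (Real.sqrt n * (((((b n) * (n) : ℕ) : ℝ) * replicaSEsq (fun j (x : ℕ → Ω) => (∑ i ∈
            Finset.range (b n), f (x ((b n) * j + i))) / (b n)) (n) x) / (2 * ((∑ t ∈ Finset.range
            ((b n) * (n)), f (x t) ^ 2) / (((b n) * (n) : ℕ) : ℝ) - ((∑ t ∈ Finset.range ((b n) *
            (n)), f (x t)) / (((b n) * (n) : ℕ) : ℝ)) ^ 2)) - tauInt (fun t => autocov (κ) (π) (fun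
            y => f y - ∫ z, f z ∂(π)) t / autocov (κ) (π) (fun y => f y - ∫ z, f z ∂(π)) 0)))
        = Real.sqrt n * (c * (((((b n) * (n) : ℕ) : ℝ) * replicaSEsq (fun j (x : ℕ → Ω) => (∑ i ∈
              Finset.range (b n), f (x ((b n) * j + i))) / (b n)) (n) x) / (2 * ((∑ t ∈
              Finset.range ((b n) * (n)), f (x t) ^ 2) / (((b n) * (n) : ℕ) : ℝ) - ((∑ t ∈
              Finset.range ((b n) * (n)), f (x t)) / (((b n) * (n) : ℕ) : ℝ)) ^ 2))) - c * tauInt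
              (fun t => autocov (κ) (π) (fun y => f y - ∫ z, f z ∂(π)) t / autocov (κ) (π) (fun y
              => f y - ∫ z, f z ∂(π)) 0))
      ring))
    (ae_of_all _ fun ω => (by
      show c * (Real.sqrt 2 * tauInt (fun t => autocov (κ) (π) (fun y => f y - ∫ z, f z ∂(π)) t /
            autocov (κ) (π) (fun y => f y - ∫ z, f z ∂(π)) 0) * Y ω) = Real.sqrt 2 * (c * tauInt
            (fun t => autocov (κ) (π) (fun y => f y - ∫ z, f z ∂(π)) t / autocov (κ) (π) (fun y =>
            f y - ∫ z, f z ∂(π)) 0)) * Y ω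
      ring))

omit [MeasurableSpace Ω₁] [MeasurableSpace Ω₂] in
/-- **The printed squared error bar of `c τ̂_int` is consistent**: `n · (2 (c τ̂_n)²/n) → 2 (c τ_int)²`
in probability (envelope, any start, `Var_π f ≠ 0`, `b_n → ∞`). -/
theorem chain_batchMeans_costTauInt_errorBar_tendstoInMeasure_of_envelope (hπ : Kernel.Invariant κ
      π)
    (henv : ∀ (g : Ω → ℝ), Measurable g → ∀ (Cg : ℝ), (∀ x, |g x| ≤ Cg) →
      ∀ (t : ℕ) (x : Ω), |(kop κ)^[t] g x - ∫ y, g y ∂π| ≤ 2 * Cg * (A * ρ ^ t))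
    (hA : 0 ≤ A) (hρ0 : 0 ≤ ρ) (hρ1 : ρ < 1)
    {f : Ω → ℝ} (hf : Measurable f) {C : ℝ} (hC : ∀ x, |f x| ≤ C)
    (hvar : autocov κ π (fun y => f y - ∫ z, f z ∂π) 0 ≠ 0)
    (μ₀ : Measure Ω) [IsProbabilityMeasure μ₀] {b : ℕ → ℕ} (hb : Tendsto b atTop atTop) (c : ℝ)
    [IsProbabilityMeasure (Kernel.trajMeasure (X := fun _ : ℕ => Ω) (μ₀)
          (fun n : ℕ => κ.comap (fun h' : (i : ↥(Finset.Iic n)) → Ω => h' ⟨n, Finset.mem_Iic.2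
                le_rfl⟩)
            (measurable_pi_apply _)))] :
    TendstoInMeasure (Kernel.trajMeasure (X := fun _ : ℕ => Ω) (μ₀)
          (fun n : ℕ => κ.comap (fun h' : (i : ↥(Finset.Iic n)) → Ω => h' ⟨n, Finset.mem_Iic.2
                le_rfl⟩)
            (measurable_pi_apply _))) (fun (n : ℕ) (x : ℕ → Ω) =>
        (n : ℝ) * (2 * (c * (((((b n) * (n) : ℕ) : ℝ) * replicaSEsq (fun j (x : ℕ → Ω) => (∑ i ∈
              Finset.range (b n), f (x ((b n) * j + i))) / (b n)) (n) x) / (2 * ((∑ t ∈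
              Finset.range ((b n) * (n)), f (x t) ^ 2) / (((b n) * (n) : ℕ) : ℝ) - ((∑ t ∈
              Finset.range ((b n) * (n)), f (x t)) / (((b n) * (n) : ℕ) : ℝ)) ^ 2)))) ^ 2 / n))
      atTop (fun _ => 2 * (c * tauInt (fun t => autocov (κ) (π) (fun y => f y - ∫ z, f z ∂(π)) t /
            autocov (κ) (π) (fun y => f y - ∫ z, f z ∂(π)) 0)) ^ 2) := by
  have hcons := chain_batchMeans_tauInt_tendstoInMeasure_of_envelope hπ henv hA hρ0 hρ1 hf hC hvar
    μ₀ (a := fun n => n) (b := b) tendsto_id hb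
  have h2 := tendstoInMeasure_pair_comp hcons hcons (ψ := fun p : ℝ × ℝ => 2 * (c * p.1) ^ 2)
    (by fun_prop)
  refine h2.congr' ?_ (Eventually.of_forall fun _ => rfl)
  filter_upwards [eventually_ge_atTop 1] with n hn
  refine Eventually.of_forall fun x => ?_
  have hn0 : (n : ℝ) ≠ 0 := by exact_mod_cast (show n ≠ 0 by omega)
  field_simp

omit [MeasurableSpace Ω₁] [MeasurableSpace Ω₂] in
/-- Measurability of `c τ̂_int`. -/
theorem measurable_costTauInt {f : Ω → ℝ} (hf : Measurable f) (c : ℝ) (b n : ℕ) :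
    Measurable fun x : ℕ → Ω => c * (((((b) * (n) : ℕ) : ℝ) * replicaSEsq (fun j (x : ℕ → Ω) => (∑
          i ∈ Finset.range (b), f (x ((b) * j + i))) / (b)) (n) x) / (2 * ((∑ t ∈ Finset.range ((b)
          * (n)), f (x t) ^ 2) / (((b) * (n) : ℕ) : ℝ) - ((∑ t ∈ Finset.range ((b) * (n)), f (x t))
          / (((b) * (n) : ℕ) : ℝ)) ^ 2))) :=
  ((measurable_batchMeans_sigmaHat hf n b).div
    ((((Finset.measurable_sum _ fun _ _ => (hf.pow_const 2).comp (measurable_pi_apply _)).div_const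
      _).sub (((Finset.measurable_sum _ fun _ _ => hf.comp (measurable_pi_apply _)).div_const
        _).pow_const 2)).const_mul _)).const_mul c

omit [MeasurableSpace Ω₁] [MeasurableSpace Ω₂] in
/-- `τ_int > 0` when `Var_π f ≠ 0` and `σ²_f > 0`. -/
theorem tauInt_pos_of_greenKubo_pos (κ : Kernel Ω Ω) [IsMarkovKernel κ] (π : Measure Ω)
    [IsProbabilityMeasure π] (f : Ω → ℝ)
    (hvar : autocov κ π (fun y => f y - ∫ z, f z ∂π) 0 ≠ 0) (hσ : 0 < ((∫ y, (f y - ∫ z, f z ∂(π))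
          ^ 2 ∂(π)) + 2 * ∑' k, ∫ y, (f y - ∫ z, f z ∂(π)) * (kop (κ))^[k + 1] (fun y => f y - ∫ z,
          f z ∂(π)) y ∂(π))) :
    0 < tauInt (fun t => autocov (κ) (π) (fun y => f y - ∫ z, f z ∂(π)) t / autocov (κ) (π) (fun y
          => f y - ∫ z, f z ∂(π)) 0) := by
  have hγ0 : autocov κ π (fun y => f y - ∫ z, f z ∂π) 0 = ∫ z, (f z - ∫ z', f z' ∂π) ^ 2 ∂π :=
    autocov_zero κ π (fun y => f y - ∫ z, f z ∂π)
  have hv0 : 0 < autocov κ π (fun y => f y - ∫ z, f z ∂π) 0 :=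
    lt_of_le_of_ne (by rw [hγ0]; exact integral_nonneg fun _ => sq_nonneg _) (Ne.symm hvar)
  have hσe : ((∫ y, (f y - ∫ z, f z ∂(π)) ^ 2 ∂(π)) + 2 * ∑' k, ∫ y, (f y - ∫ z, f z ∂(π)) * (kop
        (κ))^[k + 1] (fun y => f y - ∫ z, f z ∂(π)) y ∂(π)) = 2 * autocov κ π (fun y => f y - ∫ z,
        f z ∂π) 0 * tauInt (fun t => autocov (κ) (π) (fun y => f y - ∫ z, f z ∂(π)) t / autocov (κ)
        (π) (fun y => f y - ∫ z, f z ∂(π)) 0) := by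
    rw [two_mul_mul_tauInt_eq hvar, autocov_zero]
    rfl
  have : tauInt (fun t => autocov (κ) (π) (fun y => f y - ∫ z, f z ∂(π)) t / autocov (κ) (π) (fun y
        => f y - ∫ z, f z ∂(π)) 0) = ((∫ y, (f y - ∫ z, f z ∂(π)) ^ 2 ∂(π)) + 2 * ∑' k, ∫ y, (f y -
        ∫ z, f z ∂(π)) * (kop (κ))^[k + 1] (fun y => f y - ∫ z, f z ∂(π)) y ∂(π)) / (2 * autocov κ
        π (fun y => f y - ∫ z, f z ∂π) 0) := by
    rw [hσe]; field_simp
  rw [this]; positivity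

end OneSampler

/-- **THE COST-WEIGHTED `τ_int` COMPARISON TEST IS CALIBRATED UNDER THE NULL (envelopes).**  See
the module docstring.  `Y, Z ~ N(0, 1)` auxiliary; `c₁ τ_int,1 = c₂ τ_int,2`. -/
theorem chain_batchMeans_twoSampler_costTauInt_clt_of_envelope
    (hπ₁ : Kernel.Invariant κ₁ π₁)
    (henv₁ : ∀ (g : Ω₁ → ℝ), Measurable g → ∀ (Cg : ℝ), (∀ x, |g x| ≤ Cg) →
      ∀ (t : ℕ) (x : Ω₁), |(kop κ₁)^[t] g x - ∫ y, g y ∂π₁| ≤ 2 * Cg * (A₁ * ρ₁ ^ t))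
    (hA₁ : 0 ≤ A₁) (hρ0₁ : 0 ≤ ρ₁) (hρ1₁ : ρ₁ < 1)
    {f₁ : Ω₁ → ℝ} (hf₁ : Measurable f₁) {C₁ : ℝ} (hC₁ : ∀ x, |f₁ x| ≤ C₁)
    (hvar₁ : autocov κ₁ π₁ (fun y => f₁ y - ∫ z, f₁ z ∂π₁) 0 ≠ 0) (hσ₁ : 0 < ((∫ y, (f₁ y - ∫ z, f₁
          z ∂(π₁)) ^ 2 ∂(π₁)) + 2 * ∑' k, ∫ y, (f₁ y - ∫ z, f₁ z ∂(π₁)) * (kop (κ₁))^[k + 1] (fun y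
          => f₁ y - ∫ z, f₁ z ∂(π₁)) y ∂(π₁)))
    (hπ₂ : Kernel.Invariant κ₂ π₂)
    (henv₂ : ∀ (g : Ω₂ → ℝ), Measurable g → ∀ (Cg : ℝ), (∀ x, |g x| ≤ Cg) →
      ∀ (t : ℕ) (x : Ω₂), |(kop κ₂)^[t] g x - ∫ y, g y ∂π₂| ≤ 2 * Cg * (A₂ * ρ₂ ^ t))
    (hA₂ : 0 ≤ A₂) (hρ0₂ : 0 ≤ ρ₂) (hρ1₂ : ρ₂ < 1)
    {f₂ : Ω₂ → ℝ} (hf₂ : Measurable f₂) {C₂ : ℝ} (hC₂ : ∀ x, |f₂ x| ≤ C₂)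
    (hvar₂ : autocov κ₂ π₂ (fun y => f₂ y - ∫ z, f₂ z ∂π₂) 0 ≠ 0)
    {c₁ c₂ : ℝ} (hc₁ : 0 < c₁)
    (hH0 : c₁ * tauInt (fun t => autocov (κ₁) (π₁) (fun y => f₁ y - ∫ z, f₁ z ∂(π₁)) t / autocov
          (κ₁) (π₁) (fun y => f₁ y - ∫ z, f₁ z ∂(π₁)) 0) = c₂ * tauInt (fun t => autocov (κ₂) (π₂)
          (fun y => f₂ y - ∫ z, f₂ z ∂(π₂)) t / autocov (κ₂) (π₂) (fun y => f₂ y - ∫ z, f₂ z ∂(π₂))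
          0))
    (μ₁ : Measure Ω₁) [IsProbabilityMeasure μ₁] (μ₂ : Measure Ω₂) [IsProbabilityMeasure μ₂]
    {b₁ b₂ : ℕ → ℕ} (hb₁ : Tendsto b₁ atTop atTop) (hb₂ : Tendsto b₂ atTop atTop)
    (hab₁ : Tendsto (fun n : ℕ => (n : ℝ) / (b₁ n : ℝ) ^ 2) atTop (𝓝 0))
    (hab₂ : Tendsto (fun n : ℕ => (n : ℝ) / (b₂ n : ℝ) ^ 2) atTop (𝓝 0))
    {m : ℕ → ℕ} (hm : Tendsto m atTop atTop)
    {Ω' : Type*} [MeasurableSpace Ω'] {P' : Measure Ω'} [IsProbabilityMeasure P'] {Y Z : Ω' → ℝ}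
    (hY : HasLaw Y (gaussianReal 0 1) P') (hZ : HasLaw Z (gaussianReal 0 1) P')
    [IsProbabilityMeasure (Kernel.trajMeasure (X := fun _ : ℕ => Ω₁) (μ₁)
          (fun n : ℕ => (κ₁).comap (fun h' : (i : ↥(Finset.Iic n)) → Ω₁ => h' ⟨n, Finset.mem_Iic.2
                le_rfl⟩)
            (measurable_pi_apply _)))] [IsProbabilityMeasure (Kernel.trajMeasure (X := fun _ : ℕ =>
                  Ω₂) (μ₂)
          (fun n : ℕ => (κ₂).comap (fun h' : (i : ↥(Finset.Iic n)) → Ω₂ => h' ⟨n, Finset.mem_Iic.2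
                le_rfl⟩)
            (measurable_pi_apply _)))] :
    TendstoInDistribution (fun (n : ℕ) (ω : (ℕ → Ω₁) × (ℕ → Ω₂)) =>
        (c₁ * (((((b₁ n) * (n) : ℕ) : ℝ) * replicaSEsq (fun j (x : ℕ → Ω₁) => (∑ i ∈ Finset.range
              (b₁ n), f₁ (x ((b₁ n) * j + i))) / (b₁ n)) (n) ω.1) / (2 * ((∑ t ∈ Finset.range ((b₁
              n) * (n)), f₁ (ω.1 t) ^ 2) / (((b₁ n) * (n) : ℕ) : ℝ) - ((∑ t ∈ Finset.range ((b₁ n)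
              * (n)), f₁ (ω.1 t)) / (((b₁ n) * (n) : ℕ) : ℝ)) ^ 2)))
          - c₂ * (((((b₂ (m n)) * (m n) : ℕ) : ℝ) * replicaSEsq (fun j (x : ℕ → Ω₂) => (∑ i ∈
                Finset.range (b₂ (m n)), f₂ (x ((b₂ (m n)) * j + i))) / (b₂ (m n))) (m n) ω.2) / (2
                * ((∑ t ∈ Finset.range ((b₂ (m n)) * (m n)), f₂ (ω.2 t) ^ 2) / (((b₂ (m n)) * (m n)
                : ℕ) : ℝ) - ((∑ t ∈ Finset.range ((b₂ (m n)) * (m n)), f₂ (ω.2 t)) / (((b₂ (m n)) *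
                (m n) : ℕ) : ℝ)) ^ 2))))
        / Real.sqrt (2 * (c₁ * (((((b₁ n) * (n) : ℕ) : ℝ) * replicaSEsq (fun j (x : ℕ → Ω₁) => (∑ i
              ∈ Finset.range (b₁ n), f₁ (x ((b₁ n) * j + i))) / (b₁ n)) (n) ω.1) / (2 * ((∑ t ∈
              Finset.range ((b₁ n) * (n)), f₁ (ω.1 t) ^ 2) / (((b₁ n) * (n) : ℕ) : ℝ) - ((∑ t ∈
              Finset.range ((b₁ n) * (n)), f₁ (ω.1 t)) / (((b₁ n) * (n) : ℕ) : ℝ)) ^ 2)))) ^ 2 / n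
            + 2 * (c₂ * (((((b₂ (m n)) * (m n) : ℕ) : ℝ) * replicaSEsq (fun j (x : ℕ → Ω₂) => (∑ i
                  ∈ Finset.range (b₂ (m n)), f₂ (x ((b₂ (m n)) * j + i))) / (b₂ (m n))) (m n) ω.2)
                  / (2 * ((∑ t ∈ Finset.range ((b₂ (m n)) * (m n)), f₂ (ω.2 t) ^ 2) / (((b₂ (m n))
                  * (m n) : ℕ) : ℝ) - ((∑ t ∈ Finset.range ((b₂ (m n)) * (m n)), f₂ (ω.2 t)) /
                  (((b₂ (m n)) * (m n) : ℕ) : ℝ)) ^ 2)))) ^ 2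
              / (m n)))
      atTop Z (fun _ => ((Kernel.trajMeasure (X := fun _ : ℕ => Ω₁) (μ₁)
            (fun n : ℕ => (κ₁).comap (fun h' : (i : ↥(Finset.Iic n)) → Ω₁ => h' ⟨n,
                  Finset.mem_Iic.2 le_rfl⟩)
              (measurable_pi_apply _)))).prod ((Kernel.trajMeasure (X := fun _ : ℕ => Ω₂) (μ₂)
            (fun n : ℕ => (κ₂).comap (fun h' : (i : ↥(Finset.Iic n)) → Ω₂ => h' ⟨n,
                  Finset.mem_Iic.2 le_rfl⟩)
              (measurable_pi_apply _))))) P' := by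
  set τ₁ := tauInt (fun t => autocov (κ₁) (π₁) (fun y => f₁ y - ∫ z, f₁ z ∂(π₁)) t / autocov (κ₁)
        (π₁) (fun y => f₁ y - ∫ z, f₁ z ∂(π₁)) 0) with hτ₁
  set τ₂ := tauInt (fun t => autocov (κ₂) (π₂) (fun y => f₂ y - ∫ z, f₂ z ∂(π₂)) t / autocov (κ₂)
        (π₂) (fun y => f₂ y - ∫ z, f₂ z ∂(π₂)) 0) with hτ₂
  have hτ0 : 0 < τ₁ := tauInt_pos_of_greenKubo_pos κ₁ π₁ f₁ hvar₁ hσ₁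
  have hs : 0 < 2 * (c₁ * τ₁) ^ 2 := by positivity
  have hY₁ := hasLaw_sqrt_two_mul_const_mul_gaussian hY (c₁ * τ₁)
  -- one-run cost-weighted CLTs (common centre `c₁ τ₁ = c₂ τ₂`) and error bars
  have hsc₁ := chain_batchMeans_costTauInt_clt_of_envelope hπ₁ henv₁ hA₁ hρ0₁ hρ1₁ hf₁ hC₁ hvar₁ μ₁
    hb₁ hab₁ c₁ hY
  have hsc₂ := chain_batchMeans_costTauInt_clt_of_envelope hπ₂ henv₂ hA₂ hρ0₂ hρ1₂ hf₂ hC₂ hvar₂ μ₂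
    hb₂ hab₂ c₂ hY
  have hV₁ := chain_batchMeans_costTauInt_errorBar_tendstoInMeasure_of_envelope hπ₁ henv₁ hA₁ hρ0₁
    hρ1₁ hf₁ hC₁ hvar₁ μ₁ hb₁ c₁
  have hV₂ := chain_batchMeans_costTauInt_errorBar_tendstoInMeasure_of_envelope hπ₂ henv₂ hA₂ hρ0₂
    hρ1₂ hf₂ hC₂ hvar₂ μ₂ hb₂ c₂
  rw [← hτ₁] at hsc₁ hV₁
  rw [← hτ₂, ← hH0] at hsc₂ hV₂
  have key := CardConsistency.twoSample_agreement_clt_of_tendstoInMeasure (PA :=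
        (Kernel.trajMeasure (X := fun _ : ℕ => Ω₁) (μ₁)
        (fun n : ℕ => (κ₁).comap (fun h' : (i : ↥(Finset.Iic n)) → Ω₁ => h' ⟨n, Finset.mem_Iic.2
              le_rfl⟩)
          (measurable_pi_apply _))))
    (PB := (Kernel.trajMeasure (X := fun _ : ℕ => Ω₂) (μ₂)
          (fun n : ℕ => (κ₂).comap (fun h' : (i : ↥(Finset.Iic n)) → Ω₂ => h' ⟨n, Finset.mem_Iic.2
                le_rfl⟩)
            (measurable_pi_apply _)))) hs hs
    (fun n => measurable_costTauInt hf₁ c₁ (b₁ n) n)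
    (fun n => ((measurable_costTauInt hf₁ c₁ (b₁ n) n).pow_const 2 |>.const_mul 2).div_const _)
    (fun n => measurable_costTauInt hf₂ c₂ (b₂ n) n)
    (fun n => ((measurable_costTauInt hf₂ c₂ (b₂ n) n).pow_const 2 |>.const_mul 2).div_const _)
    hsc₁ hY₁ hsc₂ hY₁ hV₁ hV₂ hm hZ
  exact key

/-- **COVERAGE OF THE COST-WEIGHTED `τ_int` COMPARISON TEST UNDER THE NULL.**  Under the hypotheses of
`chain_batchMeans_twoSampler_costTauInt_clt_of_envelope` (the auxiliary Gaussians being realised on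
`ℝ × ℝ`), for every real `z`:
`(P¹_{μ₁} ⊗ P²_{μ₂}) {|c₁ τ̂₁ − c₂ τ̂₂| / √(2c₁²τ̂₁²/n + 2c₂²τ̂₂²/m_n) ≤ z} → (gaussianReal 0 1)[−z, z]`. -/
theorem chain_batchMeans_twoSampler_costTauInt_coverage_of_envelope
    (hπ₁ : Kernel.Invariant κ₁ π₁)
    (henv₁ : ∀ (g : Ω₁ → ℝ), Measurable g → ∀ (Cg : ℝ), (∀ x, |g x| ≤ Cg) →
      ∀ (t : ℕ) (x : Ω₁), |(kop κ₁)^[t] g x - ∫ y, g y ∂π₁| ≤ 2 * Cg * (A₁ * ρ₁ ^ t))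
    (hA₁ : 0 ≤ A₁) (hρ0₁ : 0 ≤ ρ₁) (hρ1₁ : ρ₁ < 1)
    {f₁ : Ω₁ → ℝ} (hf₁ : Measurable f₁) {C₁ : ℝ} (hC₁ : ∀ x, |f₁ x| ≤ C₁)
    (hvar₁ : autocov κ₁ π₁ (fun y => f₁ y - ∫ z, f₁ z ∂π₁) 0 ≠ 0) (hσ₁ : 0 < ((∫ y, (f₁ y - ∫ z, f₁
          z ∂(π₁)) ^ 2 ∂(π₁)) + 2 * ∑' k, ∫ y, (f₁ y - ∫ z, f₁ z ∂(π₁)) * (kop (κ₁))^[k + 1] (fun y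
          => f₁ y - ∫ z, f₁ z ∂(π₁)) y ∂(π₁)))
    (hπ₂ : Kernel.Invariant κ₂ π₂)
    (henv₂ : ∀ (g : Ω₂ → ℝ), Measurable g → ∀ (Cg : ℝ), (∀ x, |g x| ≤ Cg) →
      ∀ (t : ℕ) (x : Ω₂), |(kop κ₂)^[t] g x - ∫ y, g y ∂π₂| ≤ 2 * Cg * (A₂ * ρ₂ ^ t))
    (hA₂ : 0 ≤ A₂) (hρ0₂ : 0 ≤ ρ₂) (hρ1₂ : ρ₂ < 1)
    {f₂ : Ω₂ → ℝ} (hf₂ : Measurable f₂) {C₂ : ℝ} (hC₂ : ∀ x, |f₂ x| ≤ C₂)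
    (hvar₂ : autocov κ₂ π₂ (fun y => f₂ y - ∫ z, f₂ z ∂π₂) 0 ≠ 0)
    {c₁ c₂ : ℝ} (hc₁ : 0 < c₁)
    (hH0 : c₁ * tauInt (fun t => autocov (κ₁) (π₁) (fun y => f₁ y - ∫ z, f₁ z ∂(π₁)) t / autocov
          (κ₁) (π₁) (fun y => f₁ y - ∫ z, f₁ z ∂(π₁)) 0) = c₂ * tauInt (fun t => autocov (κ₂) (π₂)
          (fun y => f₂ y - ∫ z, f₂ z ∂(π₂)) t / autocov (κ₂) (π₂) (fun y => f₂ y - ∫ z, f₂ z ∂(π₂))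
          0))
    (μ₁ : Measure Ω₁) [IsProbabilityMeasure μ₁] (μ₂ : Measure Ω₂) [IsProbabilityMeasure μ₂]
    {b₁ b₂ : ℕ → ℕ} (hb₁ : Tendsto b₁ atTop atTop) (hb₂ : Tendsto b₂ atTop atTop)
    (hab₁ : Tendsto (fun n : ℕ => (n : ℝ) / (b₁ n : ℝ) ^ 2) atTop (𝓝 0))
    (hab₂ : Tendsto (fun n : ℕ => (n : ℝ) / (b₂ n : ℝ) ^ 2) atTop (𝓝 0))
    {m : ℕ → ℕ} (hm : Tendsto m atTop atTop)
    [IsProbabilityMeasure (Kernel.trajMeasure (X := fun _ : ℕ => Ω₁) (μ₁)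
          (fun n : ℕ => (κ₁).comap (fun h' : (i : ↥(Finset.Iic n)) → Ω₁ => h' ⟨n, Finset.mem_Iic.2
                le_rfl⟩)
            (measurable_pi_apply _)))] [IsProbabilityMeasure (Kernel.trajMeasure (X := fun _ : ℕ =>
                  Ω₂) (μ₂)
          (fun n : ℕ => (κ₂).comap (fun h' : (i : ↥(Finset.Iic n)) → Ω₂ => h' ⟨n, Finset.mem_Iic.2
                le_rfl⟩)
            (measurable_pi_apply _)))] (z : ℝ) :
    Tendsto (fun n : ℕ => (((Kernel.trajMeasure (X := fun _ : ℕ => Ω₁) (μ₁)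
          (fun n : ℕ => (κ₁).comap (fun h' : (i : ↥(Finset.Iic n)) → Ω₁ => h' ⟨n, Finset.mem_Iic.2
                le_rfl⟩)
            (measurable_pi_apply _)))).prod ((Kernel.trajMeasure (X := fun _ : ℕ => Ω₂) (μ₂)
          (fun n : ℕ => (κ₂).comap (fun h' : (i : ↥(Finset.Iic n)) → Ω₂ => h' ⟨n, Finset.mem_Iic.2
                le_rfl⟩)
            (measurable_pi_apply _))))).real
      {ω : (ℕ → Ω₁) × (ℕ → Ω₂) | |(c₁ * (((((b₁ n) * (n) : ℕ) : ℝ) * replicaSEsq (fun j (x : ℕ →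
            Ω₁) => (∑ i ∈ Finset.range (b₁ n), f₁ (x ((b₁ n) * j + i))) / (b₁ n)) (n) ω.1) / (2 *
            ((∑ t ∈ Finset.range ((b₁ n) * (n)), f₁ (ω.1 t) ^ 2) / (((b₁ n) * (n) : ℕ) : ℝ) - ((∑ t
            ∈ Finset.range ((b₁ n) * (n)), f₁ (ω.1 t)) / (((b₁ n) * (n) : ℕ) : ℝ)) ^ 2)))
          - c₂ * (((((b₂ (m n)) * (m n) : ℕ) : ℝ) * replicaSEsq (fun j (x : ℕ → Ω₂) => (∑ i ∈
                Finset.range (b₂ (m n)), f₂ (x ((b₂ (m n)) * j + i))) / (b₂ (m n))) (m n) ω.2) / (2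
                * ((∑ t ∈ Finset.range ((b₂ (m n)) * (m n)), f₂ (ω.2 t) ^ 2) / (((b₂ (m n)) * (m n)
                : ℕ) : ℝ) - ((∑ t ∈ Finset.range ((b₂ (m n)) * (m n)), f₂ (ω.2 t)) / (((b₂ (m n)) *
                (m n) : ℕ) : ℝ)) ^ 2))))
        / Real.sqrt (2 * (c₁ * (((((b₁ n) * (n) : ℕ) : ℝ) * replicaSEsq (fun j (x : ℕ → Ω₁) => (∑ i
              ∈ Finset.range (b₁ n), f₁ (x ((b₁ n) * j + i))) / (b₁ n)) (n) ω.1) / (2 * ((∑ t ∈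
              Finset.range ((b₁ n) * (n)), f₁ (ω.1 t) ^ 2) / (((b₁ n) * (n) : ℕ) : ℝ) - ((∑ t ∈
              Finset.range ((b₁ n) * (n)), f₁ (ω.1 t)) / (((b₁ n) * (n) : ℕ) : ℝ)) ^ 2)))) ^ 2 / n
            + 2 * (c₂ * (((((b₂ (m n)) * (m n) : ℕ) : ℝ) * replicaSEsq (fun j (x : ℕ → Ω₂) => (∑ i
                  ∈ Finset.range (b₂ (m n)), f₂ (x ((b₂ (m n)) * j + i))) / (b₂ (m n))) (m n) ω.2)
                  / (2 * ((∑ t ∈ Finset.range ((b₂ (m n)) * (m n)), f₂ (ω.2 t) ^ 2) / (((b₂ (m n))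
                  * (m n) : ℕ) : ℝ) - ((∑ t ∈ Finset.range ((b₂ (m n)) * (m n)), f₂ (ω.2 t)) /
                  (((b₂ (m n)) * (m n) : ℕ) : ℝ)) ^ 2)))) ^ 2
              / (m n))| ≤ z})
      atTop (𝓝 ((gaussianReal 0 1).real (Set.Icc (-z) z))) := by
  have hY : HasLaw (fun p : ℝ × ℝ => p.1) (gaussianReal 0 1)
      ((gaussianReal 0 1).prod (gaussianReal 0 1)) :=
    ⟨measurable_fst.aemeasurable, by
      rw [show (fun p : ℝ × ℝ => p.1) = Prod.fst from rfl, Measure.map_fst_prod, measure_univ,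
        one_smul]⟩
  have hZ : HasLaw (fun p : ℝ × ℝ => p.2) (gaussianReal 0 1)
      ((gaussianReal 0 1).prod (gaussianReal 0 1)) :=
    ⟨measurable_snd.aemeasurable, by
      rw [show (fun p : ℝ × ℝ => p.2) = Prod.snd from rfl, Measure.map_snd_prod, measure_univ,
        one_smul]⟩
  exact CardConsistency.tendsto_measureReal_abs_le_gaussian
    (chain_batchMeans_twoSampler_costTauInt_clt_of_envelope hπ₁ henv₁ hA₁ hρ0₁ hρ1₁ hf₁ hC₁ hvar₁
          hσ₁
      hπ₂ henv₂ hA₂ hρ0₂ hρ1₂ hf₂ hC₂ hvar₂ hc₁ hH0 μ₁ μ₂ hb₁ hb₂ hab₁ hab₂ hm hY hZ) hZ z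

end Summit.Ventures.LatticeQCDFlow.Scoring

end
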